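import Summits.BirchSwinnertonDyer.BirchSwinnertonDyer.Theorems.Rank1ResidualIntModelReduction
import Summits.BirchSwinnertonDyer.Rank1Residual.X11b.CertificateRecordsGeneric
import Literature.NumberTheory.EllipticCurves.ComplexMultiplicationLocalFactorsAux
import Literature.NumberTheory.EllipticCurves.PointCountEulerCriterion
import HarnessLib

/-!
# Small-image strand (O8 / N2–N3 axis): `irr(5)` by a FROBENIUS CERTIFICATE in the kernel for the non-CM index-zero pairs of the Ш-census rule V16 — part A (`2268b1` · `6372a1` · `7200bu1` · `7688j1` · `7688k1`)

HONEST FRAMING (cell `b2b-bsdres`, run/shared/lean/b2b/bsd-rank1-residual/, verbatim in every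
file): the goal of the cell is to DELETE the COMBINATION-SHAPED residual classes of the
Birch–Swinnerton-Dyer formula for ALL analytic-rank `≤ 1` elliptic curves over `ℚ` — "full BSD
formula for every rank `≤ 1` curve in class `C`" assembled STRICTLY from published theorems — so
that the rank-`≤ 1` remainder becomes exactly the CONSTRUCTION-SHAPED classes, which are TYPED
(missing-input `Prop`s), NOT attempted. This is not "finishing BSD". CLASS-CLOSURE lane, seat
cc-typer-1 (typer of record for the non-surjective-image strand O8 and the joint small-image axis
N2/N3), generation 13: PER-PAIR RECORDS (model definitions + theorems; no named fact, no axiom, no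
`sorry`); nothing is booked by this file; no label and no census number moves; every open class stays
open. Parts `B`, `C`, `D` are the sibling files (17 records in all; the parts are independent — the two
generic helpers are repeated as `private` declarations in each, suffixed by the part letter).

## What this file records

The Ш-census seat `b2b-bsdres-sha-2` (GEN 15, rule V16; `HOME/b2b-bsdres-sha-2/gen15/x411/V16.json`,
`METHODS-x411.md` §3b) closes 17 never-eligible NON-CM pairs `(E, 5)` whose mod-`5` image is NOT
surjective (ecdata image codes `5S4`, `5Ns`, `5Nn`) through the GENERIC Matar–Nekovář consumer
`Literature.….Rank1Residual.Typed.bsdp_of_matarNekovar_of_not_dvd_index` (p199938; Matar–Nekovář, JTNB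
**31** (2019) Thm. 6.7 (1): IRREDUCIBILITY of `E[p]`, not surjectivity, is the image input), with the
Heegner-index binder from a two-engine height-ratio certificate and the binder `hirr` from Mazur's
Frobenius criterion at a witness prime found by two implementations (`frobirr.py` naive count; PARI
`ellap`, kit job j135765; 1224/1224 agree). That seat asked (INBOX 2026-08-21T17:39Z, "x1b /
cc-typer") for the irreducibility input to be made a KERNEL THEOREM per pair, exactly as
`X12/FrobeniusIrrRecords.lean` (harvest-1 g13) did for `7569a1 @29` / `15129a1 @41`. These files do
that with the cell's integer-model toolkit (`IntModel.hasIrreducibleModPGaloisRep_of_intModel_of_noroot`,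
`Rank1ResidualIntModelReduction.lean`, x11c): for the globally minimal `W` with integral model `E₀`, a
good prime `ℓ ≠ p` with `#(E₀ mod ℓ)(𝔽_ℓ) = n` such that `X² − (ℓ + 1 − n)X + ℓ` has NO root in `ℤ/p`
forces `E[p]` to be irreducible (a `Γ_ℚ`-stable line carries an isogeny character `r` with
`r(φ_ℓ)² − a_ℓ r(φ_ℓ) + ℓ = 0` in `𝔽_p`; Mazur 1978 Prop. 6.3 (1)). The point counts `#Ẽ(𝔽_ℓ)`
(`ℓ ∈ {3, 7, 11, 13}`, the least witness of V16.json) are KERNEL-DECIDED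
(`natCard_point_eq_one_add_card` + `card_sol_eq_sum_euler` + `decide`), as are `ℓ ∤ Δ(E₀)` and the
root-freeness checks mod `5`; a third implementation (this seat's pure-python driver) recomputed every
`#Ẽ(𝔽_ℓ)` before typing. GLOBAL MINIMALITY of Cremona's reduced model is decided in the kernel from the
SUPPORT of `Δ` by x11c's per-prime test (`X11b.isGloballyMinimal_of_krausCriterion_support`,
`X11b/KrausMinimalityGeneralTwo.lean`; packaged as the Bool check `minSupportCheck` = trial-division
primality of the listed primes + `|Δ| = ∏ q^{v_q Δ}` + `X11b.minCheckAt` at each `q`: Silverman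
`q¹² ∤ Δ ∨ q⁴ ∤ c₄` (AEC VII.1 Rem. 1.1), or the integer Kraus test at `q = 2`, or `3⁸ ‖ c₆` at `q = 3`),
so every record is HYPOTHESIS-FREE (over the 17: Silverman settles every bad prime of 15 models;
`11552j1` needs Kraus at `2`, `16200j1` needs `3⁸ ‖ c₆`).

| pair | Cremona minimal model `[a₁,a₂,a₃,a₄,a₆]` | census family | image at `5` | `r` | witness | `#Ẽ(𝔽_ℓ)` | `a_ℓ` | minimality at the bad primes |
|---|---|---|---|---|---|---|---|---|
| `2268b1 @5` | `[0, 0, 0, -1161, 16389]` | X9 | `5S4` | 0 | `ℓ = 11` | `13` | `-1` | Silverman |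
| `6372a1 @5` | `[0, 0, 0, -43605, -2755431]` | X7 | `5Nn` | 0 | `ℓ = 7` | `8` | `0` | Silverman |
| `7200bu1 @5` | `[0, 0, 0, -1875, 36250]` | X4 (O8) | `5Ns` | 0 | `ℓ = 13` | `14` | `0` | Silverman |
| `7688j1 @5` | `[0, 1, 0, -72, -256]` | X9 | `2Cn/5S4` | 1 | `ℓ = 7` | `3` | `5` | Silverman |
| `7688k1 @5` | `[0, -1, 0, -196, 1124]` | X9 | `2Cn/5S4` | 1 | `ℓ = 11` | `11` | `1` | Silverman |

Every `X² − a_ℓX + ℓ` above is root-free mod `5` (kernel-decided below). NOT in these files: the 18th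
V16 row `2450d1 @7` and the O8 rows `2450ba1 / 2450bd1 @7` (image `7Ns.3.1`: every good Frobenius has
an `𝔽₇`-rational eigenvalue, so no Frobenius witness exists — sha-2 GEN 15; `irr(7)` there needs the
isogeny-character argument itself). Result: **`Irr W 5` with NO hypothesis for each pair of this part**;
the irreducibility input of the Matar–Nekovář consumer is then a kernel theorem BY NAME
(`hirr := irr_cremona…`). Nothing else about these pairs is asserted: the Heegner-index certificate,
`#Ш_an`, `r_an ≤ 1` and GZK remain that consumer's other binders, discharged (or not) by the census,
never by this file.

Data sources: a-invariants and conductors = Cremona's `allcurves` table as copied into `V16.json`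
(`minimal_model_ainvs`, `N`); `(q, v_q N, v_q Δ)` recomputed by this seat; witnesses = `V16.json`
(`witness_impl1` = `impl2_least_witness_independent`). References: B. Mazur, Invent. Math. 44 (1978)
§5, Prop. 6.3 (1) [Mazur1978]; J. E. Cremona, *Algorithms for Modular Elliptic Curves* (1997), Table 1
[Cremona1997]; J. H. Silverman, *AEC* (2009) VII.1 Rem. 1.1, VIII.8 [SilvermanAEC2009]; A. Kraus,
Manuscripta Math. 65 (1989) Prop. 1, Prop. 2 [Kraus1989]; A. Matar, J. Nekovář, JTNB 31 (2019)
Thm. 6.7 (1) [MatarNekovar2019] (consumer only; not used here).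
-/

set_option autoImplicit false

noncomputable section

open scoped Classical

open WeierstrassCurve Literature.NumberTheory.EllipticCurves
  Literature.NumberTheory.EllipticCurves.Rank1Residual
  Literature.NumberTheory.EllipticCurves.Rank1Residual.X11RankOneCertificates
  Summit.BirchSwinnertonDyer.BirchSwinnertonDyer.Rank1Residual

namespace Summit.BirchSwinnertonDyer.Rank1Residual.GaloisImage.SmallImageRecords

/-- `5` is prime. -/
instance factPrimeFiveA : Fact (Nat.Prime 5) := ⟨by norm_num⟩

/-- `7` is prime (Frobenius witness prime). -/
instance factPrimeSevenA : Fact (Nat.Prime 7) := ⟨by norm_num⟩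

/-- `11` is prime (Frobenius witness prime). -/
instance factPrimeElevenA : Fact (Nat.Prime 11) := ⟨by norm_num⟩

/-- `13` is prime (Frobenius witness prime). -/
instance factPrimeThirteenA : Fact (Nat.Prime 13) := ⟨by norm_num⟩

/-! ## §0 Two generic helpers for a literal integer model over `ℚ` (private; repeated in each part) -/

/-- An integer Weierstrass model with `Δ ≠ 0` is an elliptic curve over `ℚ` (`Δ` is the tree-rechecked
integer `discOf` of `X11RankOneCertificates/Schema.lean`). [cite: SilvermanAEC2009, III.1 (p. 42)] -/
private theorem isElliptic_of_discOf_ne_zeroA (a1 a2 a3 a4 a6 : ℤ)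
    (h : discOf [a1, a2, a3, a4, a6] ≠ 0) : (⟨a1, a2, a3, a4, a6⟩ : WeierstrassCurve ℚ).IsElliptic := by
  refine ⟨?_⟩
  have hΔ : (⟨a1, a2, a3, a4, a6⟩ : WeierstrassCurve ℚ).Δ = ((discOf [a1, a2, a3, a4, a6] : ℤ) : ℚ) := by
    simp only [WeierstrassCurve.Δ, WeierstrassCurve.b₂, WeierstrassCurve.b₄, WeierstrassCurve.b₆,
      WeierstrassCurve.b₈, discOf, invariants]
    push_cast
    ring
  rw [hΔ, isUnit_iff_ne_zero]
  exact_mod_cast h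

/-- The support-based minimality test evaluated per record: every listed `q` is prime (trial division
below `710²`), `|Δ(a)| = ∏ q^{v_q Δ}` over the list, and x11c's per-prime test `X11b.minCheckAt`
(Silverman `q¹² ∤ Δ ∨ q⁴ ∤ c₄`, or the integer Kraus test at `q = 2`, or `3⁸ ‖ c₆` at `q = 3`). Entries
`(q, v_q N, v_q Δ)`; `v_q N` is documentation. [folklore] -/
private def minSupportCheckA (a : List ℤ) (bad : List (ℕ × ℕ × ℕ)) : Bool :=
  bad.all (fun t => isPrimeBelow504100 t.1) &&
  (((bad.map fun t => t.1 ^ t.2.2).prod : ℕ) == (discOf a).natAbs) &&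
  bad.all (X11b.minCheckAt a)

/-- Global minimality of a literal integer model from a passing `minSupportCheckA` (soundness = x11c's
`X11b.isGloballyMinimal_of_krausCriterion_support`; unpacking as in `X11b.isGloballyMinimal_of_minCheck`).
[cite: SilvermanAEC2009, VII.1 Remark 1.1 and VIII.8] [cite: Kraus1989, Prop. 1 and Prop. 2] -/
private theorem isGloballyMinimal_of_minSupportCheckA (a1 a2 a3 a4 a6 : ℤ) (bad : List (ℕ × ℕ × ℕ))
    (h : minSupportCheckA [a1, a2, a3, a4, a6] bad = true) :
    (⟨a1, a2, a3, a4, a6⟩ : WeierstrassCurve ℚ).IsGloballyMinimal := by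
  simp only [minSupportCheckA, Bool.and_eq_true, List.all_eq_true, beq_iff_eq] at h
  obtain ⟨⟨hpr, hprod⟩, hmin⟩ := h
  refine X11b.isGloballyMinimal_of_krausCriterion_support a1 a2 a3 a4 a6 bad
    (fun t ht ↦ prime_of_isPrimeBelow504100 (hpr t ht)) hprod.symm fun t ht ↦ ?_
  have hmt := hmin t ht
  simp only [X11b.minCheckAt, Bool.or_eq_true, Bool.and_eq_true, decide_eq_true_eq, beq_iff_eq] at hmt
  rcases hmt with ((h12 | h4) | ⟨⟨⟨h2, h16⟩, h64⟩, hk⟩) | ⟨⟨h3, h8⟩, h9⟩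
  · exact Or.inl (Or.inl h12)
  · exact Or.inl (Or.inr h4)
  · exact Or.inr (Or.inl ⟨h2, h16, h64, hk⟩)
  · exact Or.inr (Or.inr ⟨h3, h8, h9⟩)

/-! ## §1 `2268b1 @ 5` (image `5S4`, census family X9, `r = 0`) -/

/-- `#Ẽ(𝔽_{11}) = 13` for `[0, 0, 0, -1161, 16389]` (`a_{11} = -1`). Kernel-decided. [folklore] -/
theorem card_2268b1_mod11 :
    Nat.card (((⟨0, 0, 0, -1161, 16389⟩ : WeierstrassCurve ℤ).map
      (Int.castRingHom (ZMod 11))).toAffine.Point) = 13 := by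
  rw [@WeierstrassCurve.natCard_point_eq_one_add_card (ZMod 11) (@ZMod.instField 11 ⟨by norm_num⟩)
    _ _ _ (by decide +kernel), @card_sol_eq_sum_euler (ZMod 11) (@ZMod.instField 11 ⟨by norm_num⟩)
    _ _ (by rw [ZMod.ringChar_zmod_n]; decide), ZMod.card]
  decide +kernel

/-- Cremona `2268b1`: `[0, 0, 0, -1161, 16389]` (`N = 2268`; good reduction at `5`, small image; V16 row `2268b1@5`). [cite: Cremona1997, Table 1 (curve 2268b1)] -/
def cremona2268b1 : WeierstrassCurve ℚ := ⟨0, 0, 0, -1161, 16389⟩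

/-- `2268b1` is an elliptic curve (`Δ = -15878984688 ≠ 0`). -/
instance isElliptic_cremona2268b1 : cremona2268b1.IsElliptic := by
  have h := isElliptic_of_discOf_ne_zeroA 0 0 0 (-1161) 16389 (by decide)
  norm_num at h
  exact h

/-- `[0, 0, 0, -1161, 16389]` is globally minimal, kernel-decided from the support `(q, v_q N, v_q Δ) = [(2, 2, 4), (3, 4, 10), (7, 1, 5)]` of
`Δ = -15878984688` (`c₄ = 55728`, `c₆ = -14160096`): Silverman at every bad prime.
[cite: SilvermanAEC2009, VII.1 Remark 1.1 and VIII.8] [cite: Kraus1989, Prop. 1 and Prop. 2] -/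
instance isGloballyMinimal_cremona2268b1 : cremona2268b1.IsGloballyMinimal := by
  have h := isGloballyMinimal_of_minSupportCheckA 0 0 0 (-1161) 16389 [(2, 2, 4), (3, 4, 10), (7, 1, 5)] (by decide +kernel)
  norm_num at h
  exact h

/-- The integral model of `2268b1` is `[0, 0, 0, -1161, 16389]`. [folklore] -/
theorem integralModelInt_cremona2268b1 : integralModelInt cremona2268b1 = ⟨0, 0, 0, -1161, 16389⟩ :=
  IntModel.integralModelInt_eq_of_map_eq _ (by ext <;> simp [WeierstrassCurve.map, cremona2268b1])

/-- **RECORD `2268b1 @ 5`: `E[5]` is irreducible — Frobenius certificate at `ℓ = 11` (`#Ẽ(𝔽_{11}) = 13`,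
`a_{11} = -1`; `X² + X + 11` root-free mod `5`), kernel-decided, NO hypothesis.**
[cite: Mazur1978, §5 (p. 148) and §6 Prop. 6.3 (1) (p. 153)] -/
theorem irr_cremona2268b1 : Irr cremona2268b1 5 :=
  IntModel.hasIrreducibleModPGaloisRep_of_intModel_of_noroot integralModelInt_cremona2268b1 5 11
    (by norm_num) (by decide) card_2268b1_mod11 (by decide)

/-! ## §2 `6372a1 @ 5` (image `5Nn`, census family X7, `r = 0`) -/

/-- `#Ẽ(𝔽_{7}) = 8` for `[0, 0, 0, -43605, -2755431]` (`a_{7} = 0`). Kernel-decided. [folklore] -/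
theorem card_6372a1_mod7 :
    Nat.card (((⟨0, 0, 0, -43605, -2755431⟩ : WeierstrassCurve ℤ).map
      (Int.castRingHom (ZMod 7))).toAffine.Point) = 8 := by
  rw [@WeierstrassCurve.natCard_point_eq_one_add_card (ZMod 7) (@ZMod.instField 7 ⟨by norm_num⟩)
    _ _ _ (by decide +kernel), @card_sol_eq_sum_euler (ZMod 7) (@ZMod.instField 7 ⟨by norm_num⟩)
    _ _ (by rw [ZMod.ringChar_zmod_n]; decide), ZMod.card]
  decide +kernel

/-- Cremona `6372a1`: `[0, 0, 0, -43605, -2755431]` (`N = 6372`; census family X7; V16 row `6372a1@5`). [cite: Cremona1997, Table 1 (curve 6372a1)] -/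
def cremona6372a1 : WeierstrassCurve ℚ := ⟨0, 0, 0, -43605, -2755431⟩

/-- `6372a1` is an elliptic curve (`Δ = 2026347116719248 ≠ 0`). -/
instance isElliptic_cremona6372a1 : cremona6372a1.IsElliptic := by
  have h := isElliptic_of_discOf_ne_zeroA 0 0 0 (-43605) (-2755431) (by decide)
  norm_num at h
  exact h

/-- `[0, 0, 0, -43605, -2755431]` is globally minimal, kernel-decided from the support `(q, v_q N, v_q Δ) = [(2, 2, 4), (3, 3, 11), (59, 1, 5)]` of
`Δ = 2026347116719248` (`c₄ = 2093040`, `c₆ = 2380692384`): Silverman at every bad prime.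
[cite: SilvermanAEC2009, VII.1 Remark 1.1 and VIII.8] [cite: Kraus1989, Prop. 1 and Prop. 2] -/
instance isGloballyMinimal_cremona6372a1 : cremona6372a1.IsGloballyMinimal := by
  have h := isGloballyMinimal_of_minSupportCheckA 0 0 0 (-43605) (-2755431) [(2, 2, 4), (3, 3, 11), (59, 1, 5)] (by decide +kernel)
  norm_num at h
  exact h

/-- The integral model of `6372a1` is `[0, 0, 0, -43605, -2755431]`. [folklore] -/
theorem integralModelInt_cremona6372a1 : integralModelInt cremona6372a1 = ⟨0, 0, 0, -43605, -2755431⟩ :=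
  IntModel.integralModelInt_eq_of_map_eq _ (by ext <;> simp [WeierstrassCurve.map, cremona6372a1])

/-- **RECORD `6372a1 @ 5`: `E[5]` is irreducible — Frobenius certificate at `ℓ = 7` (`#Ẽ(𝔽_{7}) = 8`,
`a_{7} = 0`; `X² + 7` root-free mod `5`), kernel-decided, NO hypothesis.**
[cite: Mazur1978, §5 (p. 148) and §6 Prop. 6.3 (1) (p. 153)] -/
theorem irr_cremona6372a1 : Irr cremona6372a1 5 :=
  IntModel.hasIrreducibleModPGaloisRep_of_intModel_of_noroot integralModelInt_cremona6372a1 5 7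
    (by norm_num) (by decide) card_6372a1_mod7 (by decide)

/-! ## §3 `7200bu1 @ 5` (image `5Ns`, census family X4, `r = 0`) -/

/-- `#Ẽ(𝔽_{13}) = 14` for `[0, 0, 0, -1875, 36250]` (`a_{13} = 0`). Kernel-decided. [folklore] -/
theorem card_7200bu1_mod13 :
    Nat.card (((⟨0, 0, 0, -1875, 36250⟩ : WeierstrassCurve ℤ).map
      (Int.castRingHom (ZMod 13))).toAffine.Point) = 14 := by
  rw [@WeierstrassCurve.natCard_point_eq_one_add_card (ZMod 13) (@ZMod.instField 13 ⟨by norm_num⟩)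
    _ _ _ (by decide +kernel), @card_sol_eq_sum_euler (ZMod 13) (@ZMod.instField 13 ⟨by norm_num⟩)
    _ _ (by rw [ZMod.ringChar_zmod_n]; decide), ZMod.card]
  decide +kernel

/-- Cremona `7200bu1`: `[0, 0, 0, -1875, 36250]` (`N = 7200`; additive at `5`; an O8 pair (additive at `5`, non-surjective image); V16 row `7200bu1@5`). [cite: Cremona1997, Table 1 (curve 7200bu1)] -/
def cremona7200bu1 : WeierstrassCurve ℚ := ⟨0, 0, 0, -1875, 36250⟩

/-- `7200bu1` is an elliptic curve (`Δ = -145800000000 ≠ 0`). -/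
instance isElliptic_cremona7200bu1 : cremona7200bu1.IsElliptic := by
  have h := isElliptic_of_discOf_ne_zeroA 0 0 0 (-1875) 36250 (by decide)
  norm_num at h
  exact h

/-- `[0, 0, 0, -1875, 36250]` is globally minimal, kernel-decided from the support `(q, v_q N, v_q Δ) = [(2, 5, 9), (3, 2, 6), (5, 2, 8)]` of
`Δ = -145800000000` (`c₄ = 90000`, `c₆ = -31320000`): Silverman at every bad prime.
[cite: SilvermanAEC2009, VII.1 Remark 1.1 and VIII.8] [cite: Kraus1989, Prop. 1 and Prop. 2] -/
instance isGloballyMinimal_cremona7200bu1 : cremona7200bu1.IsGloballyMinimal := by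
  have h := isGloballyMinimal_of_minSupportCheckA 0 0 0 (-1875) 36250 [(2, 5, 9), (3, 2, 6), (5, 2, 8)] (by decide +kernel)
  norm_num at h
  exact h

/-- The integral model of `7200bu1` is `[0, 0, 0, -1875, 36250]`. [folklore] -/
theorem integralModelInt_cremona7200bu1 : integralModelInt cremona7200bu1 = ⟨0, 0, 0, -1875, 36250⟩ :=
  IntModel.integralModelInt_eq_of_map_eq _ (by ext <;> simp [WeierstrassCurve.map, cremona7200bu1])

/-- **RECORD `7200bu1 @ 5`: `E[5]` is irreducible — Frobenius certificate at `ℓ = 13` (`#Ẽ(𝔽_{13}) = 14`,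
`a_{13} = 0`; `X² + 13` root-free mod `5`), kernel-decided, NO hypothesis.**
[cite: Mazur1978, §5 (p. 148) and §6 Prop. 6.3 (1) (p. 153)] -/
theorem irr_cremona7200bu1 : Irr cremona7200bu1 5 :=
  IntModel.hasIrreducibleModPGaloisRep_of_intModel_of_noroot integralModelInt_cremona7200bu1 5 13
    (by norm_num) (by decide) card_7200bu1_mod13 (by decide)

/-! ## §4 `7688j1 @ 5` (image `2Cn/5S4`, census family X9, `r = 1`) -/

/-- `#Ẽ(𝔽_{7}) = 3` for `[0, 1, 0, -72, -256]` (`a_{7} = 5`). Kernel-decided. [folklore] -/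
theorem card_7688j1_mod7 :
    Nat.card (((⟨0, 1, 0, -72, -256⟩ : WeierstrassCurve ℤ).map
      (Int.castRingHom (ZMod 7))).toAffine.Point) = 3 := by
  rw [@WeierstrassCurve.natCard_point_eq_one_add_card (ZMod 7) (@ZMod.instField 7 ⟨by norm_num⟩)
    _ _ _ (by decide +kernel), @card_sol_eq_sum_euler (ZMod 7) (@ZMod.instField 7 ⟨by norm_num⟩)
    _ _ (by rw [ZMod.ringChar_zmod_n]; decide), ZMod.card]
  decide +kernel

/-- Cremona `7688j1`: `[0, 1, 0, -72, -256]` (`N = 7688`; good reduction at `5`, small image; V16 row `7688j1@5`). [cite: Cremona1997, Table 1 (curve 7688j1)] -/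
def cremona7688j1 : WeierstrassCurve ℚ := ⟨0, 1, 0, -72, -256⟩

/-- `7688j1` is an elliptic curve (`Δ = 984064 ≠ 0`). -/
instance isElliptic_cremona7688j1 : cremona7688j1.IsElliptic := by
  have h := isElliptic_of_discOf_ne_zeroA 0 1 0 (-72) (-256) (by decide)
  norm_num at h
  exact h

/-- `[0, 1, 0, -72, -256]` is globally minimal, kernel-decided from the support `(q, v_q N, v_q Δ) = [(2, 3, 10), (31, 2, 2)]` of
`Δ = 984064` (`c₄ = 3472`, `c₆ = 200384`): Silverman at every bad prime.
[cite: SilvermanAEC2009, VII.1 Remark 1.1 and VIII.8] [cite: Kraus1989, Prop. 1 and Prop. 2] -/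
instance isGloballyMinimal_cremona7688j1 : cremona7688j1.IsGloballyMinimal := by
  have h := isGloballyMinimal_of_minSupportCheckA 0 1 0 (-72) (-256) [(2, 3, 10), (31, 2, 2)] (by decide +kernel)
  norm_num at h
  exact h

/-- The integral model of `7688j1` is `[0, 1, 0, -72, -256]`. [folklore] -/
theorem integralModelInt_cremona7688j1 : integralModelInt cremona7688j1 = ⟨0, 1, 0, -72, -256⟩ :=
  IntModel.integralModelInt_eq_of_map_eq _ (by ext <;> simp [WeierstrassCurve.map, cremona7688j1])

/-- **RECORD `7688j1 @ 5`: `E[5]` is irreducible — Frobenius certificate at `ℓ = 7` (`#Ẽ(𝔽_{7}) = 3`,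
`a_{7} = 5`; `X² − 5X + 7` root-free mod `5`), kernel-decided, NO hypothesis.**
[cite: Mazur1978, §5 (p. 148) and §6 Prop. 6.3 (1) (p. 153)] -/
theorem irr_cremona7688j1 : Irr cremona7688j1 5 :=
  IntModel.hasIrreducibleModPGaloisRep_of_intModel_of_noroot integralModelInt_cremona7688j1 5 7
    (by norm_num) (by decide) card_7688j1_mod7 (by decide)

/-! ## §5 `7688k1 @ 5` (image `2Cn/5S4`, census family X9, `r = 1`) -/

/-- `#Ẽ(𝔽_{11}) = 11` for `[0, -1, 0, -196, 1124]` (`a_{11} = 1`). Kernel-decided. [folklore] -/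
theorem card_7688k1_mod11 :
    Nat.card (((⟨0, -1, 0, -196, 1124⟩ : WeierstrassCurve ℤ).map
      (Int.castRingHom (ZMod 11))).toAffine.Point) = 11 := by
  rw [@WeierstrassCurve.natCard_point_eq_one_add_card (ZMod 11) (@ZMod.instField 11 ⟨by norm_num⟩)
    _ _ _ (by decide +kernel), @card_sol_eq_sum_euler (ZMod 11) (@ZMod.instField 11 ⟨by norm_num⟩)
    _ _ (by rw [ZMod.ringChar_zmod_n]; decide), ZMod.card]
  decide +kernel

/-- Cremona `7688k1`: `[0, -1, 0, -196, 1124]` (`N = 7688`; good reduction at `5`, small image; V16 row `7688k1@5`). [cite: Cremona1997, Table 1 (curve 7688k1)] -/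
def cremona7688k1 : WeierstrassCurve ℚ := ⟨0, -1, 0, -196, 1124⟩

/-- `7688k1` is an elliptic curve (`Δ = 246016 ≠ 0`). -/
instance isElliptic_cremona7688k1 : cremona7688k1.IsElliptic := by
  have h := isElliptic_of_discOf_ne_zeroA 0 (-1) 0 (-196) 1124 (by decide)
  norm_num at h
  exact h

/-- `[0, -1, 0, -196, 1124]` is globally minimal, kernel-decided from the support `(q, v_q N, v_q Δ) = [(2, 3, 8), (31, 2, 2)]` of
`Δ = 246016` (`c₄ = 9424`, `c₆ = -914624`): Silverman at every bad prime.
[cite: SilvermanAEC2009, VII.1 Remark 1.1 and VIII.8] [cite: Kraus1989, Prop. 1 and Prop. 2] -/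
instance isGloballyMinimal_cremona7688k1 : cremona7688k1.IsGloballyMinimal := by
  have h := isGloballyMinimal_of_minSupportCheckA 0 (-1) 0 (-196) 1124 [(2, 3, 8), (31, 2, 2)] (by decide +kernel)
  norm_num at h
  exact h

/-- The integral model of `7688k1` is `[0, -1, 0, -196, 1124]`. [folklore] -/
theorem integralModelInt_cremona7688k1 : integralModelInt cremona7688k1 = ⟨0, -1, 0, -196, 1124⟩ :=
  IntModel.integralModelInt_eq_of_map_eq _ (by ext <;> simp [WeierstrassCurve.map, cremona7688k1])

/-- **RECORD `7688k1 @ 5`: `E[5]` is irreducible — Frobenius certificate at `ℓ = 11` (`#Ẽ(𝔽_{11}) = 11`,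
`a_{11} = 1`; `X² − X + 11` root-free mod `5`), kernel-decided, NO hypothesis.**
[cite: Mazur1978, §5 (p. 148) and §6 Prop. 6.3 (1) (p. 153)] -/
theorem irr_cremona7688k1 : Irr cremona7688k1 5 :=
  IntModel.hasIrreducibleModPGaloisRep_of_intModel_of_noroot integralModelInt_cremona7688k1 5 11
    (by norm_num) (by decide) card_7688k1_mod11 (by decide)

/-! ## §6 Summary of part A -/

/-- **Part A: `irr(5)` in the kernel, NO hypothesis, for `2268b1`, `6372a1`, `7200bu1`, `7688j1`, `7688k1`.** Per-pair records; nothing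
booked; no class statement. [cite: Mazur1978, §6 Prop. 6.3 (1) (p. 153)] -/
theorem irr_five_frobenius_recordsA :
    Irr cremona2268b1 5 ∧
    Irr cremona6372a1 5 ∧
    Irr cremona7200bu1 5 ∧
    Irr cremona7688j1 5 ∧
    Irr cremona7688k1 5 :=
  ⟨irr_cremona2268b1, irr_cremona6372a1, irr_cremona7200bu1, irr_cremona7688j1, irr_cremona7688k1⟩

end Summit.BirchSwinnertonDyer.Rank1Residual.GaloisImage.SmallImageRecords

end
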